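import Mathlib
import Summits.Ventures.PercRepro2.CoinContract
import Summits.Ventures.PercRepro2.CoinContractDarc
import Summits.Ventures.PercRepro2.CoinKStar

/-!
# Row 2′DARC at every k-STAR head with a TARGET SET (blind cell PercRepro2, night-2 g5;
proofs/NIGHT2-DARC.md §26, §18)

`darc_of_kStar_mixed_set`: `darc_of_kStar_mixed` for a target set `T` (the leaves `vᵢ → T`), by
the §18 contraction of `T` to a single vertex `t₀ ∈ T` (`darc_contract_iff`).
-/

namespace Summit.Ventures.PercRepro2.Coin

section KStarSet

open Classical

variable {V : Type*} {E : Type*} [Fintype V] [DecidableEq V] [Fintype E] [DecidableEq E]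
  {R : Type*} [Field R] [LinearOrder R] [IsStrictOrderedRing R]

/-- **THEOREM (row 2′DARC at every k-star pendant head, target SET).** -/
theorem darc_of_kStar_mixed_set (p : E → R) (hp : IsProbVec p) {arcs : E → Finset (V × V)}
    (hS : SameEnds arcs) (s a b u w : V) {T : Finset V} {t₀ : V} (ht₀ : t₀ ∈ T) (Vs : Finset V)
    (hwV : w ∉ Vs) (hPT : Disjoint (insert w Vs) T) (hs : s ∉ T)
    (hclosed : ClosedOut arcs (insert w Vs) T) (hT : TailCoinsIn arcs (insert w Vs) T)
    {c d : V → E} (hcd : ∀ v ∈ Vs, ∀ v' ∈ Vs, c v ≠ d v') (hc : Set.InjOn c Vs)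
    (hd : Set.InjOn d Vs) (hleaf : ∀ v ∈ Vs, bwdEvent arcs v T = openEdge (d v))
    (hhead : bwdEvent arcs w T = ⋃ v ∈ Vs, (openEdge (c v) ∩ openEdge (d v)))
    (ha : a ∉ insert w Vs ∪ T) (hb : b ∉ insert w Vs ∪ T) (hu : u ∉ insert w Vs ∪ T)
    (hP : ∀ Z ∈ (insert w Vs).powerset,
      0 < prob p (avoidEvent (arcsOff arcs (insert w Vs ∪ T)) s (Z ∪ T)))
    (hQ : ∀ Z ∈ (insert w Vs).powerset,
      0 < prob p (avoidEvent (arcsOff arcs (insert w Vs ∪ T)) s (gateTarget u w Z T))) :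
    DARC p arcs s T a b u w := by
  have hwT : w ∉ T := Finset.disjoint_left.mp hPT (Finset.mem_insert_self w Vs)
  have hvT : ∀ v ∈ Vs, v ∉ T := fun v hv =>
    Finset.disjoint_left.mp hPT (Finset.mem_insert_of_mem hv)
  have haT : a ∉ T := fun h => ha (Finset.mem_union_right _ h)
  have hbT : b ∉ T := fun h => hb (Finset.mem_union_right _ h)
  have huT : u ∉ T := fun h => hu (Finset.mem_union_right _ h)
  rw [darc_contract_iff p ht₀ hs haT hbT huT hwT]
  refine darc_of_kStar_mixed p hp (sameEnds_contract hS) s a b u w t₀ Vs hwV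
    (closedOut_contract ht₀ hPT hclosed) (tailCoinsIn_contract ht₀ hPT hT) hcd hc hd
    (fun v hv => by rw [← bwdEvent_contract ht₀ (hvT v hv)]; exact hleaf v hv)
    (by rw [← bwdEvent_contract ht₀ hwT]; exact hhead) ?_ ?_ ?_ ?_ ?_
  · intro h
    rcases Finset.mem_union.mp h with h | h
    · exact ha (Finset.mem_union_left _ h)
    · exact haT (Finset.mem_singleton.mp h ▸ ht₀)
  · intro h
    rcases Finset.mem_union.mp h with h | h
    · exact hb (Finset.mem_union_left _ h)
    · exact hbT (Finset.mem_singleton.mp h ▸ ht₀)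
  · intro h
    rcases Finset.mem_union.mp h with h | h
    · exact hu (Finset.mem_union_left _ h)
    · exact huT (Finset.mem_singleton.mp h ▸ ht₀)
  · intro Z hZ
    rw [avoid_reduced_contract ht₀ hPT hs (Finset.mem_powerset.mp hZ)]
    exact hP Z hZ
  · intro Z hZ
    rw [avoid_reduced_gate_contract ht₀ hPT hs huT (Finset.mem_powerset.mp hZ)]
    exact hQ Z hZ

end KStarSet

end Summit.Ventures.PercRepro2.Coin
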